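import Mathlib.Analysis.Convex.Contractible
import Mathlib.AlgebraicTopology.FundamentalGroupoid.SimplyConnected
import Literature.Geometry.Riemannian.RiemannianCoveringCriterion
import Literature.Geometry.Riemannian.DominatedMetricComplete
import Literature.Geometry.Lorentzian.ModelDataCompletenessProofs
import Literature.Geometry.Lorentzian.SpacelikeSpatialProjection
import Literature.Geometry.Lorentzian.InitialData
import Literature.Geometry.Lorentzian.HypersurfaceRestriction
import Literature.Topology.CoveringSpaces.SimplyConnectedBaseCovering
import Literature.Topology.FourManifolds.ImmersionCriterion
import Literature.Geometry.Lorentzian.SpacelikeGraphMinkowski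
import HarnessLib

/-!
# The spatial projection of a complete spacelike immersed hypersurface of Minkowski space-time
# is a homeomorphism onto `ℝ³`

The last step of the proof of the rigid positive energy theorem (Beig–Chruściel, J. Math. Phys.
37 (1996), Thm. 4.1, §4, last paragraph): "Let `X₀` be the Killing vector field equal to `n^μ`
… the function `t` gives a global slicing of `M̂`, with complete leaves … the map `Φ : Σ̃ → ℝ³`
is a local diffeomorphism satisfying `|X|_δ ≥ |X|_g`; as `(Σ, g)` is complete, `Φ` is a covering
[C3, Lemma 1 and Thm. 1], hence a bijection since `ℝ³` is simply connected." Here, for a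
connected `3`-dimensional data set `(X, h, k)` with complete `h` and a spacelike immersion
`f : X → (ℝ⁴, η)` with `f^*η = h` (e.g. the developing map of `KIDGlobalImmersion.lean`):

* `InitialDataSet.isHomeomorph_spatial_comp_of_isComplete` — **`π ∘ f : X → ℝ³` is a
  homeomorphism**: `Φ = π ∘ f` is an equidimensional immersion whose pullback of the Euclidean
  metric dominates `h` (`SpacelikeSpatialProjection.lean`), hence is complete
  (`isGeodesicallyComplete_of_val_le`, Hopf–Rinow; Gordon 1973), so `Φ` is a covering map by the
  covering criterion for local isometries (Lee 2018, Thm. 6.23;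
  `CartanHadamard.surjective_and_isCoveringMap_of_isGeodesicallyComplete`) and a homeomorphism
  because `ℝ³` is simply connected (`IsCoveringMap.isHomeomorph_of_simplyConnectedSpace`);
* `InitialDataSet.injective_and_nonempty_homeomorph_of_isComplete` — so `f` is injective and
  `X ≅ ℝ³`;
* `InitialDataSet.isSmoothEmbedding_of_isComplete` — and `f` is a smooth embedding whose image
  is the entire graph `{(u(y), y)}` of a continuous height function `u` over `{t = 0}`.

(The Cauchy property of the image, which needs the asymptotic flatness, is not treated here.)
Theorems only; no definitions, no named facts.

## References

* R. Beig, P. T. Chruściel, *Killing vectors in asymptotically flat space-times. I.*, J. Math.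
  Phys. 37 (1996) 1939–1961, proof of Thm. 4.1, §4. [BeigChrusciel1996]
* J. M. Lee, *Introduction to Riemannian Manifolds*, 2nd ed. (2018), Thm. 6.23. [Lee2018]
* W. B. Gordon, Proc. Amer. Math. Soc. 37 (1973) 221–225. [Gordon1973]
* A. Hatcher, *Algebraic Topology* (2002), Prop. 1.39. [Hatcher2002]
-/

noncomputable section

open Bundle Set Function Filter Manifold
open scoped Manifold ContDiff Topology RealInnerProductSpace

namespace Literature.Geometry.Lorentzian

open Literature.Geometry.Riemannian Literature.Topology.CoveringSpaces PseudoRiemannianMetric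

namespace InitialDataSet

variable {X : Type*} [TopologicalSpace X] [ChartedSpace E3 X] [IsManifold (𝓡 3) ∞ X]
  [T2Space X] [ConnectedSpace X]
  (D : InitialDataSet (𝓡 3) X) [D.metric.HasLeviCivita]

/-- **The spatial projection of a complete spacelike immersed hypersurface of Minkowski
space-time is a homeomorphism onto `ℝ³`.** Let `(X, h, k)` be a connected `3`-dimensional
initial data set with `h` (geodesically) complete, and `f : X → (ℝ⁴, η)` a smooth spacelike
immersion with `f^*η = h`. Then the spatial projection `π ∘ f : X → ℝ³` is a homeomorphism.
Proof (Beig–Chruściel 1996, §4, last paragraph, with [C3, Lemma 1 and Thm. 1]): `Φ = π ∘ f` is an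
equidimensional immersion (`Minkowski.injective_spatial_comp_mfderiv`) whose pullback metric
`Φ^*δ` dominates `h` (`Minkowski.inducedBilin_self_le_norm_spatial_sq`: "`|X|_δ ≥ |X|_g`"), so
`Φ^*δ` is complete with `h` (Gordon 1973; `isGeodesicallyComplete_of_val_le`, Hopf–Rinow); a local
isometry from a complete manifold onto the connected `(ℝ³, δ)` is a covering map (Lee 2018,
Thm. 6.23; `CartanHadamard.surjective_and_isCoveringMap_of_isGeodesicallyComplete`); and a
connected covering of the simply connected `ℝ³` is a homeomorphism
(`IsCoveringMap.isHomeomorph_of_simplyConnectedSpace`).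
[cite: BeigChrusciel1996, proof of Thm. 4.1, §4 (last paragraph)] -/
theorem isHomeomorph_spatial_comp_of_isComplete (hc : D.IsComplete) {f : X → E4}
    (hfi : Minkowski.smoothMetric.toPseudoRiemannianMetric.IsSpacelikeImmersion (𝓡 3) f)
    (hind : ∀ (x : X) (v w : E3),
      Minkowski.smoothMetric.toPseudoRiemannianMetric.inducedBilin (𝓡 3) f x v w =
        D.h.inner x v w) :
    IsHomeomorph fun x ↦ E4.spatial (f x) := by
  classical
  -- the target `(slice, δ)` and the map `p = π ∘ f : X → slice`
  set g : PseudoRiemannianMetric 𝓘(ℝ, E3) ∞ E3 (TangentSpace 𝓘(ℝ, E3) : Minkowski.slice → Type _) :=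
    trivialData.metric with hg_def
  haveI hgLC : g.HasLeviCivita := g.hasLeviCivita
  set p : X → Minkowski.slice := fun x ↦ ⟨E4.spatial (f x), Minkowski.mem_slice _⟩ with hp_def
  have hfs : ContMDiff (𝓡 3) 𝓘(ℝ, E4) ∞ f := hfi.contMDiff_self
  have hps : ContMDiff (𝓡 3) 𝓘(ℝ, E3) ∞ p :=
    (ContMDiff.subtypeVal_comp_iff Minkowski.slice p).mp (E4.spatial.contMDiff.comp hfs)
  have hp1 : ContMDiff (𝓡 3) 𝓘(ℝ, E3) (∞ + 1) p := hps.of_le (le_of_eq rfl)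
  have hdp : ∀ (x : X) (v : E3),
      mfderiv (𝓡 3) 𝓘(ℝ, E3) p x v = E4.spatial (mfderiv (𝓡 3) 𝓘(ℝ, E4) f x v) := by
    intro x v
    have h1 : mfderiv (𝓡 3) 𝓘(ℝ, E3) (Subtype.val ∘ p) x =
        (mfderiv 𝓘(ℝ, E3) 𝓘(ℝ, E3) (Subtype.val : Minkowski.slice → E3) (p x)).comp
          (mfderiv (𝓡 3) 𝓘(ℝ, E3) p x) :=
      mfderiv_comp x ((contMDiff_subtype_val (n := ∞)).mdifferentiableAt (by simp))
        ((hps x).mdifferentiableAt (by simp))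
    rw [mfderiv_subtypeVal] at h1
    have h2 : mfderiv (𝓡 3) 𝓘(ℝ, E3) (Subtype.val ∘ p) x =
        (E4.spatial : E4 →L[ℝ] E3).comp (mfderiv (𝓡 3) 𝓘(ℝ, E4) f x) := by
      rw [show (Subtype.val ∘ p) = E4.spatial ∘ f from rfl,
        mfderiv_comp x E4.spatial.mdifferentiableAt ((hfs x).mdifferentiableAt (by simp)),
        ContinuousLinearMap.mfderiv_eq]
      rfl
    exact congrArg (fun L ↦ L v) (h1.symm.trans h2)
  have hp' : ∀ x, Injective (mfderiv (𝓡 3) 𝓘(ℝ, E3) p x) := fun x v w hvw ↦ by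
    apply Minkowski.injective_spatial_comp_mfderiv hfi x
    show E4.spatial (mfderiv (𝓡 3) 𝓘(ℝ, E4) f x v) = E4.spatial (mfderiv (𝓡 3) 𝓘(ℝ, E4) f x w)
    rw [← hdp, ← hdp, hvw]
  have hdim : Module.finrank ℝ E3 = Module.finrank ℝ E3 := rfl
  have hpb : contMDiff_pullbackBilin 𝓘(ℝ, E3) Minkowski.slice (𝓡 3) X ∞ :=
    fun f' hf' g' ↦ contMDiff_pullbackBilin_holds f' hf' g'
  haveI hLC : (g.comap hpb p hp1 hp' hdim).HasLeviCivita :=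
    (g.comap hpb p hp1 hp' hdim).hasLeviCivita
  -- regularity of the two Levi-Civita connections
  have hk1 : ((1 : ℕ∞) : ℕ∞ω) + 1 ≤ ∞ := by exact_mod_cast le_top
  have hkT : ((⊤ : ℕ∞) : ℕ∞ω) + 1 ≤ ∞ := le_of_eq rfl
  haveI : CovariantDerivative.ContMDiffCovariantDerivative g.leviCivita 1 :=
    ⟨g.isLocallyContMDiff_leviCivita_holds 1 hk1 univ isOpen_univ⟩
  haveI : CovariantDerivative.ContMDiffCovariantDerivative g.leviCivita ∞ :=
    ⟨g.isLocallyContMDiff_leviCivita_holds ⊤ hkT univ isOpen_univ⟩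
  haveI : CovariantDerivative.ContMDiffCovariantDerivative
      (g.comap hpb p hp1 hp' hdim).leviCivita 1 :=
    ⟨(g.comap hpb p hp1 hp' hdim).isLocallyContMDiff_leviCivita_holds 1 hk1 univ isOpen_univ⟩
  haveI : CovariantDerivative.ContMDiffCovariantDerivative
      (g.comap hpb p hp1 hp' hdim).leviCivita ∞ :=
    ⟨(g.comap hpb p hp1 hp' hdim).isLocallyContMDiff_leviCivita_holds ⊤ hkT univ isOpen_univ⟩
  -- the flat metric in the slice: `δ(a, b) = ⟪a, b⟫`
  have hgval : ∀ (y : Minkowski.slice) (a b : E3), g.val y a b = ⟪a, b⟫ := fun y a b ↦ by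
    rw [hg_def, val_metric]
    show Minkowski.flatMetric.inner y a b = _
    rw [Minkowski.flatMetric_inner]
    rfl
  -- `Φ^*δ ≥ h`, so `Φ^*δ` is complete
  have hval2 : ∀ (x : X) (v w : E3), (g.comap hpb p hp1 hp' hdim).val x v w =
      ⟪E4.spatial (mfderiv (𝓡 3) 𝓘(ℝ, E4) f x v), E4.spatial (mfderiv (𝓡 3) 𝓘(ℝ, E4) f x w)⟫ := by
    intro x v w
    rw [val_comap, pullbackBilin_apply, hgval, hdp, hdp]
  have hle : ∀ (x : X) (v : TangentSpace (𝓡 3) x),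
      D.metric.val x v v ≤ (g.comap hpb p hp1 hp' hdim).val x v v := by
    intro x v
    rw [hval2, real_inner_self_eq_norm_sq, val_metric, ← hind]
    exact Minkowski.inducedBilin_self_le_norm_spatial_sq (I' := 𝓡 3) f x v
  have h₂ : (g.comap hpb p hp1 hp' hdim).IsRiemannian := fun x v hv ↦ by
    rw [hval2, real_inner_self_eq_norm_sq]
    have hne : E4.spatial (mfderiv (𝓡 3) 𝓘(ℝ, E4) f x v) ≠ 0 := fun h0 ↦
      hv ((injective_iff_map_eq_zero _).1 (Minkowski.injective_spatial_comp_mfderiv hfi x) v h0)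
    positivity
  have hcN : IsGeodesicallyComplete (g.comap hpb p hp1 hp' hdim).leviCivita :=
    isGeodesicallyComplete_of_val_le le_rfl D.isRiemannian_metric h₂ hle hc
  have hcM : IsGeodesicallyComplete g.leviCivita := isComplete_trivialData_holds
  -- Lee's covering criterion
  obtain ⟨-, hcov⟩ := CartanHadamard.surjective_and_isCoveringMap_of_isGeodesicallyComplete
    (hpb := hpb) (hf := hp1) (hf' := hp') (hdim := hdim) hcN hcM
  -- the slice is simply connected, so `p` is a homeomorphism
  let e : Minkowski.slice ≃ₜ E3 :=
    { toFun := fun y ↦ y.1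
      invFun := fun y ↦ ⟨y, Minkowski.mem_slice y⟩
      left_inv := fun _ ↦ rfl
      right_inv := fun _ ↦ rfl
      continuous_toFun := continuous_subtype_val
      continuous_invFun := continuous_id.subtype_mk _ }
  haveI : ContractibleSpace (univ : Set E3) :=
    (convex_univ (𝕜 := ℝ) (E := E3)).contractibleSpace ⟨0, mem_univ _⟩
  haveI : ContractibleSpace E3 := (Homeomorph.Set.univ E3).symm.contractibleSpace
  haveI : ContractibleSpace Minkowski.slice := e.contractibleSpace
  haveI : LocallyPathConnectedSpace Minkowski.slice :=
    ChartedSpace.locallyPathConnectedSpace E3 Minkowski.slice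
  have hhom : IsHomeomorph p := IsCoveringMap.isHomeomorph_of_simplyConnectedSpace hcov
  exact e.isHomeomorph.comp hhom

/-- **Hence a complete spacelike immersion into Minkowski space-time inducing `h` is injective,
and `X ≅ ℝ³`** (so `X` is contractible, in particular simply connected and one-ended).
[cite: BeigChrusciel1996, proof of Thm. 4.1, §4 (last paragraph)] -/
theorem injective_and_nonempty_homeomorph_of_isComplete (hc : D.IsComplete) {f : X → E4}
    (hfi : Minkowski.smoothMetric.toPseudoRiemannianMetric.IsSpacelikeImmersion (𝓡 3) f)
    (hind : ∀ (x : X) (v w : E3),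
      Minkowski.smoothMetric.toPseudoRiemannianMetric.inducedBilin (𝓡 3) f x v w =
        D.h.inner x v w) :
    Injective f ∧ Nonempty (X ≃ₜ E3) := by
  have h := D.isHomeomorph_spatial_comp_of_isComplete hc hfi hind
  exact ⟨fun x y hxy ↦ h.bijective.1 (by simp only [hxy]), ⟨h.homeomorph _⟩⟩

/-- **… and is a smooth embedding onto an entire graph.** Under the same hypotheses `f` is a
smooth embedding (Mathlib's `Manifold.IsSmoothEmbedding`: an immersion which is a topological
embedding) and its image is the entire graph `{(u(y), y) : y ∈ ℝ³}` of the continuous function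
`u = t ∘ f ∘ (π ∘ f)⁻¹` over `{t = 0}` — the shape of `i(Σ)` in the conclusion of the rigid
positive energy theorem (Beig–Chruściel 1996, Thm. 4.1: "an isometric embedding `i` of `Σ` …
`i(Σ)` is an asymptotically flat Cauchy surface"; the Cauchy property needs the asymptotic
flatness and is not treated here).
[cite: BeigChrusciel1996, proof of Thm. 4.1, §4 (last paragraph)] -/
theorem isSmoothEmbedding_of_isComplete (hc : D.IsComplete) {f : X → E4}
    (hfi : Minkowski.smoothMetric.toPseudoRiemannianMetric.IsSpacelikeImmersion (𝓡 3) f)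
    (hind : ∀ (x : X) (v w : E3),
      Minkowski.smoothMetric.toPseudoRiemannianMetric.inducedBilin (𝓡 3) f x v w =
        D.h.inner x v w) :
    Manifold.IsSmoothEmbedding (𝓡 3) 𝓘(ℝ, E4) ∞ f ∧
      ∃ u : E3 → ℝ, Continuous u ∧ range f = range fun y : E3 ↦ E4.ofTimeSpace (u y) y := by
  have h := D.isHomeomorph_spatial_comp_of_isComplete hc hfi hind
  set φ := h.homeomorph _ with hφ_def
  have hφ : ∀ x, φ x = E4.spatial (f x) := fun _ ↦ rfl
  -- the height function over `{t = 0}`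
  set u : E3 → ℝ := fun y ↦ E4.time (f (φ.symm y)) with hu_def
  have htc : Continuous E4.time := by
    show Continuous fun x : E4 ↦ x 0
    exact (EuclideanSpace.proj (0 : Fin 4) : E4 →L[ℝ] ℝ).continuous
  have huc : Continuous u :=
    htc.comp (hfi.contMDiff_self.continuous.comp φ.symm.continuous)
  have hfac : f = (fun y : E3 ↦ E4.ofTimeSpace (u y) y) ∘ φ := by
    funext x
    have hx : φ.symm (E4.spatial (f x)) = x := φ.symm_apply_apply x
    simp only [Function.comp_apply, hu_def, hφ, hx]
    exact (E4.ofTimeSpace_time_spatial (f x)).symm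
  refine ⟨⟨Literature.Topology.FourManifolds.isImmersion_of_injective_mfderiv hfi.contMDiff_self
    (by exact_mod_cast le_top) hfi.injective_mfderiv, ?_⟩, u, huc, ?_⟩
  · rw [hfac]
    exact (Minkowski.isClosedEmbedding_graph huc).isEmbedding.comp φ.isEmbedding
  · rw [hfac, range_comp, φ.range_coe, image_univ]

end InitialDataSet

end Literature.Geometry.Lorentzian

end
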